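import Mathlib
import Summits.ValiantsHypothesis.ValiantsHypothesis.Theorems.BarrierLeverTransversalMinorLayoutsLockedComplexes
import Summits.ValiantsHypothesis.ValiantsHypothesis.Theorems.BarrierLeverTransversalTwinFreeReduction
import Summits.ValiantsHypothesis.ValiantsHypothesis.Theorems.BarrierLeverTransversalLiteralPairSplit
import Summits.ValiantsHypothesis.ValiantsHypothesis.Theorems.BarrierLeverPriorityPeelingLayoutsUpToThree

/-!
# Route BarrierLever — conjecture TT (`TransversalMinorLayoutsNonsingular`, stmt-ValiantsHypothesis-19152):
# the FINITE-CHECK PRINCIPLE — TT for a bounded number of rows is decided at bounded height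

Helper file (`--supports stmt-ValiantsHypothesis-19152`; cell valiant-natproofs, rung V4, 𝒟-side of
door (c); seat val-np-p1 gen 8).  Conventions of item 19152: a layout pair is `u w : Fin r → Finset
(Fin h)` (injective), row literal of `u i` at coordinate `a` is `castAdd h a` if `a ∈ u i` else
`natAdd h a`, column literal of `w j` at `c` is `natAdd h c` if `c ∈ w j` else `castAdd h c`, and
`(u, w)` is GOOD when some `H : Matrix (Fin (h+h)) (Fin (h+h)) ℂ` makes the `r × r` matrix of
transversal minors `det H[ρ_{u i}, τ_{w j}]` nonsingular.  TT says every injective pair is good.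

The cell already holds, as kernel theorems: the reduction of TT at fixed `(h, r)` to pairs of LOWER
SETS (simplicial complexes; `Compression.tt_sameSize_of_lowerSets`, val-np-p2), the DIMENSION LIFT
`LiteralLift.good_of_good_proj` (GOOD of the layout obtained by deleting coordinate `a` on the rows
and `c` on the columns implies GOOD; item 19588, R2 without side conditions), the literal-pair split
R1 (item 19587, `LiteralSplit.transversalLiteralPairSplit_route`) and the slices `h ≤ 3` (all `r`)
and `r ≤ 3` (all `h`) of TT (`PPSmall.transversalMinorLayouts_nonsingular_of_le_three`,
`…_of_r_le_three`, val-np-p1 g7).  This file assembles them into: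

* `card_vertices_lt` / `exists_coord_not_mem`: an injective lower-set layout with `r` members uses
  fewer than `r` coordinates (the faces `∅` and `{a}`, `a` a vertex, are distinct members), so at
  height `≥ r` some coordinate is unused;
* `tt_rows_of_height` (**HEIGHT REDUCTION**): if `r ≤ k + 1` and every injective pair
  `Fin r → Finset (Fin k)` is good, then every injective pair `Fin r → Finset (Fin h)` is good for
  every `h ≥ k` (induction on `h`: reduce to lower sets, delete an unused coordinate on each side,
  the deletions stay injective);
* `tt_rows_iff_bounded_height` (**FINITE-CHECK PRINCIPLE**): TT for `r`-row layouts at all heights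
  is equivalent to TT for `r`-row layouts at the heights `h ≤ r - 1` — finitely many layout pairs;
* `transversalMinorLayouts_nonsingular_of_r_le_four` (**TT for `r ≤ 4`, every `h`**): the finite
  check for `r ≤ 4` lives at `h ≤ 3`, where TT is a tree theorem;
* `height_lt_of_locked` / `tt_rank_le_of_lockedCore` (**BOUNDED LOCKED-COMPLEX ENGINE**, the sharp
  form of the finite check): TT for all layouts with `r ≤ R` rows follows from TT on the LOCKED
  pairs of lower-set layouts with `r ≤ R` members — pairs in which no literal class of the rows has
  the size of a literal class of the columns, so that R1 cannot split — and such pairs only occur at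
  heights `h < r` (val-np-p2's locked-complex induction `…LockedComplexes` with the rank bound
  threaded through; R1 is a tree theorem).  The companion file `…TransversalMinorLayoutsRankFive`
  runs the engine for `R = 5`.

WHAT THIS IS NOT: bounded-rank slices of TT and a reduction principle; nothing on TT / item 19761 in
general, on crux stmt-ValiantsHypothesis-14610, or on `VP` versus `VNP`.
-/

-- layout Summits/ValiantsHypothesis/ValiantsHypothesis forces the duplicated namespace component
set_option linter.dupNamespace false

open Matrix Finset

namespace Summit.ValiantsHypothesis.ValiantsHypothesis.Theorems.BarrierLever.FiniteCheck

open Summit.ValiantsHypothesis.ValiantsHypothesis.Theorems.BarrierLever.Compression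
open Summit.ValiantsHypothesis.ValiantsHypothesis.Theorems.BarrierLever.LiteralLift (good_of_good_proj)

/-! ## 1. Vertices of a complex -/

/-- In an injective lower-set layout with `0 < r` members, fewer than `r` coordinates occur in the
members: `a ↦` (the index of the face `{a}`) injects the occurring coordinates into the indices
other than that of the face `∅`. -/
theorem card_vertices_lt {h r : ℕ} (u : Fin r → Finset (Fin h))
    (hl : IsLowerSet (Set.range u)) (hr : 0 < r) :
    (Finset.univ.filter fun a : Fin h => ∃ i, a ∈ u i).card < r := by
  classical
  -- the empty face is a member
  obtain ⟨i₀, hi₀⟩ : ∃ i₀, u i₀ = ∅ :=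
    hl (show (∅ : Finset (Fin h)) ≤ u ⟨0, hr⟩ from Finset.empty_subset _) ⟨⟨0, hr⟩, rfl⟩
  -- every occurring coordinate gives a singleton face
  have hsing : ∀ a : Fin h, (∃ i, a ∈ u i) → ∃ i, u i = {a} := by
    rintro a ⟨i, hai⟩
    exact hl (show ({a} : Finset (Fin h)) ≤ u i from Finset.singleton_subset_iff.mpr hai) ⟨i, rfl⟩
  haveI : Nonempty (Fin r) := ⟨⟨0, hr⟩⟩
  choose! f hf using hsing
  calc (Finset.univ.filter fun a : Fin h => ∃ i, a ∈ u i).card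
      ≤ (Finset.univ.erase i₀).card := by
        refine Finset.card_le_card_of_injOn f ?_ ?_
        · intro a ha
          have ha' : ∃ i, a ∈ u i := by simpa using ha
          rw [Finset.coe_erase, Set.mem_sdiff, Set.mem_singleton_iff]
          refine ⟨Finset.mem_coe.mpr (Finset.mem_univ _), fun e => ?_⟩
          have h1 := hf a ha'
          rw [e, hi₀] at h1
          exact Finset.singleton_ne_empty a h1.symm
        · intro a ha b hb hab
          have ha' : ∃ i, a ∈ u i := by simpa using ha
          have hb' : ∃ i, b ∈ u i := by simpa using hb
          have h1 := hf a ha'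
          have h2 := hf b hb'
          rw [hab, h2] at h1
          exact Finset.singleton_injective h1.symm
    _ < r := by
        rw [Finset.card_erase_of_mem (Finset.mem_univ _), Finset.card_univ, Fintype.card_fin]
        omega

/-- At height `h + 1 ≥ r`, an injective lower-set layout with `r` members leaves some coordinate
unused. -/
theorem exists_coord_not_mem {h r : ℕ} (u : Fin r → Finset (Fin (h + 1)))
    (hl : IsLowerSet (Set.range u)) (hr : r ≤ h + 1) :
    ∃ a : Fin (h + 1), ∀ i, a ∉ u i := by
  classical
  rcases Nat.eq_zero_or_pos r with rfl | hr0
  · exact ⟨0, fun i => Fin.elim0 i⟩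
  have hlt := card_vertices_lt u hl hr0
  by_contra hall
  push Not at hall
  have huniv : (Finset.univ.filter fun a : Fin (h + 1) => ∃ i, a ∈ u i) = Finset.univ := by
    apply Finset.filter_true_of_mem
    intro a _
    exact hall a
  rw [huniv, Finset.card_univ, Fintype.card_fin] at hlt
  omega

/-! ## 2. Height reduction -/

/-- **HEIGHT REDUCTION.**  If `r ≤ k + 1` and the TT layout matrix is nonsingular (for some `H`) for
every pair of injective layouts `Fin r → Finset (Fin k)`, then it is nonsingular for every pair of
injective layouts `Fin r → Finset (Fin h)`, for every `h ≥ k`.  Induction on `h`: at height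
`h + 1 > k` reduce to lower sets (`tt_sameSize_of_lowerSets`), pick a coordinate unused by the rows
and one unused by the columns (`exists_coord_not_mem`, as `r ≤ h + 1`), and delete them
(`good_of_good_proj`); the deleted layouts are injective (`proj_injective_of_const_bit`) and live at
height `h`. -/
theorem tt_rows_of_height (r k : ℕ) (hrk : r ≤ k + 1)
    (base : ∀ (u w : Fin r → Finset (Fin k)), Function.Injective u → Function.Injective w →
      ∃ H : Matrix (Fin (k + k)) (Fin (k + k)) ℂ, (Matrix.of fun i j : Fin r => (H.submatrix
        (fun a : Fin k => if a ∈ u i then Fin.castAdd k a else Fin.natAdd k a)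
        (fun c : Fin k => if c ∈ w j then Fin.natAdd k c else Fin.castAdd k c)).det).det ≠ 0)
    (h : ℕ) (hkh : k ≤ h) (u w : Fin r → Finset (Fin h)) (hu : Function.Injective u)
    (hw : Function.Injective w) :
    ∃ H : Matrix (Fin (h + h)) (Fin (h + h)) ℂ, (Matrix.of fun i j : Fin r => (H.submatrix
      (fun a : Fin h => if a ∈ u i then Fin.castAdd h a else Fin.natAdd h a)
      (fun c : Fin h => if c ∈ w j then Fin.natAdd h c else Fin.castAdd h c)).det).det ≠ 0 := by
  classical
  induction h, hkh using Nat.le_induction with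
  | base => exact base u w hu hw
  | succ n hkn ih =>
    refine tt_sameSize_of_lowerSets (n + 1) r (fun u w hu hw hlu hlw => ?_) u w hu hw
    obtain ⟨a, ha⟩ := exists_coord_not_mem u hlu (by omega)
    obtain ⟨c, hc⟩ := exists_coord_not_mem w hlw (by omega)
    refine good_of_good_proj n r u w a c (ih _ _ ?_ ?_)
    · exact proj_injective_of_const_bit u hu a false (fun i => by simp [ha i])
    · exact proj_injective_of_const_bit w hw c false (fun j => by simp [hc j])

/-- **FINITE-CHECK PRINCIPLE.**  For a fixed number `r` of rows, the TT layout matrices of all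
injective `r`-row layout pairs at all heights are nonsingular (for suitable `H`) iff this holds at
the heights `h ≤ r - 1` — a finite set of layout pairs.  (Heights `h ≥ r - 1` follow from height
`r - 1` by `tt_rows_of_height`.) -/
theorem tt_rows_iff_bounded_height (r : ℕ) :
    (∀ (h : ℕ) (u w : Fin r → Finset (Fin h)), Function.Injective u → Function.Injective w →
      ∃ H : Matrix (Fin (h + h)) (Fin (h + h)) ℂ, (Matrix.of fun i j : Fin r => (H.submatrix
        (fun a : Fin h => if a ∈ u i then Fin.castAdd h a else Fin.natAdd h a)
        (fun c : Fin h => if c ∈ w j then Fin.natAdd h c else Fin.castAdd h c)).det).det ≠ 0) ↔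
    (∀ (h : ℕ), h ≤ r - 1 → ∀ (u w : Fin r → Finset (Fin h)), Function.Injective u →
      Function.Injective w →
      ∃ H : Matrix (Fin (h + h)) (Fin (h + h)) ℂ, (Matrix.of fun i j : Fin r => (H.submatrix
        (fun a : Fin h => if a ∈ u i then Fin.castAdd h a else Fin.natAdd h a)
        (fun c : Fin h => if c ∈ w j then Fin.natAdd h c else Fin.castAdd h c)).det).det ≠ 0) := by
  constructor
  · intro H h _ u w hu hw
    exact H h u w hu hw
  · intro H h u w hu hw
    by_cases hh : h ≤ r - 1
    · exact H h hh u w hu hw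
    · exact tt_rows_of_height r (r - 1) (by omega) (H (r - 1) le_rfl) h (by omega) u w hu hw

/-! ## 3. TT for at most four rows, every height -/

/-- **TT for `r ≤ 4` rows, every `h`** (conclusion of item 19152 verbatim for these layouts): the
finite check for four rows lives at height `3`, where TT is the tree theorem
`PPSmall.transversalMinorLayouts_nonsingular_of_le_three`. -/
theorem transversalMinorLayouts_nonsingular_of_r_le_four (h r : ℕ) (hr : r ≤ 4)
    (u w : Fin r → Finset (Fin h)) (hu : Function.Injective u) (hw : Function.Injective w) :
    ∃ H : Matrix (Fin (h + h)) (Fin (h + h)) ℂ, (Matrix.of fun i j : Fin r => (H.submatrix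
      (fun a : Fin h => if a ∈ u i then Fin.castAdd h a else Fin.natAdd h a)
      (fun c : Fin h => if c ∈ w j then Fin.natAdd h c else Fin.castAdd h c)).det).det ≠ 0 := by
  by_cases hh : h ≤ 3
  · exact PPSmall.transversalMinorLayouts_nonsingular_of_le_three h r hh u w hu hw
  · exact tt_rows_of_height r 3 (by omega)
      (fun u w hu hw => PPSmall.transversalMinorLayouts_nonsingular_of_le_three 3 r le_rfl u w hu hw)
      h (by omega) u w hu hw

/-! ## 4. The bounded locked-complex engine -/

/-- Two layouts each leaving a coordinate unused have literal classes of the same size `0`; so for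
a LOCKED pair of injective lower-set layouts (no literal class of the rows has the size of a literal
class of the columns) one side uses every coordinate, and by `card_vertices_lt` the height is then
below the number of members. -/
theorem height_lt_of_locked {h r : ℕ} (u w : Fin r → Finset (Fin h))
    (hlu : IsLowerSet (Set.range u)) (hlw : IsLowerSet (Set.range w)) (hr : 0 < r)
    (hlk : ∀ (a c : Fin h) (β γ : Bool),
      (Finset.univ.filter fun i => (a ∈ u i ↔ β = true)).card ≠
        (Finset.univ.filter fun j => (c ∈ w j ↔ γ = true)).card) :
    h < r := by
  classical
  by_contra hle
  push Not at hle
  have hVu := card_vertices_lt u hlu hr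
  have hVw := card_vertices_lt w hlw hr
  obtain ⟨a, ha⟩ : ∃ a : Fin h, ∀ i, a ∉ u i := by
    by_contra hall
    push Not at hall
    have e : (Finset.univ.filter fun a : Fin h => ∃ i, a ∈ u i) = Finset.univ :=
      Finset.filter_true_of_mem fun a _ => hall a
    rw [e, Finset.card_univ, Fintype.card_fin] at hVu
    omega
  obtain ⟨c, hc⟩ : ∃ c : Fin h, ∀ j, c ∉ w j := by
    by_contra hall
    push Not at hall
    have e : (Finset.univ.filter fun c : Fin h => ∃ j, c ∈ w j) = Finset.univ :=
      Finset.filter_true_of_mem fun c _ => hall c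
    rw [e, Finset.card_univ, Fintype.card_fin] at hVw
    omega
  apply hlk a c true true
  have e1 : (Finset.univ.filter fun i => (a ∈ u i ↔ true = true)) = ∅ :=
    Finset.filter_false_of_mem fun i _ => by simp [ha i]
  have e2 : (Finset.univ.filter fun j => (c ∈ w j ↔ true = true)) = ∅ :=
    Finset.filter_false_of_mem fun j _ => by simp [hc j]
  rw [e1, e2]

/-- **BOUNDED LOCKED-COMPLEX ENGINE.**  Fix a rank bound `R`.  Suppose the TT layout matrix is
nonsingular (for some `H`) for every LOCKED pair of injective lower-set layouts with `r ≤ R`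
members at a height `h < r` — locked meaning that no literal class `{i : (a ∈ u i) = β}` of the
rows has the size of a literal class `{j : (c ∈ w j) = γ}` of the columns (these are the pairs the
literal-pair split R1 cannot cut; by `height_lt_of_locked` they only occur at heights `h < r`).
Then the TT layout matrix is nonsingular for EVERY pair of injective layouts with `r ≤ R` members,
at every height.  Proof (val-np-p2's locked-complex induction with the rank bound threaded through):
induction on `h`, inside it strong induction on `r`; reduce to lower sets at fixed `(h, r)`; a
locked pair is a core case; an unlocked pair is re-indexed into block form and split by R1
(`LiteralSplit.transversalLiteralPairSplit_route`, item 19587) into a projected block one dimension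
down with at most `r` members and a complementary block with fewer members. -/
theorem tt_rank_le_of_lockedCore (R : ℕ)
    (core : ∀ (h r : ℕ), r ≤ R → h < r → ∀ (u w : Fin r → Finset (Fin h)), Function.Injective u →
      Function.Injective w → IsLowerSet (Set.range u) → IsLowerSet (Set.range w) →
      (∀ (a c : Fin h) (β γ : Bool),
        (Finset.univ.filter fun i => (a ∈ u i ↔ β = true)).card ≠
          (Finset.univ.filter fun j => (c ∈ w j ↔ γ = true)).card) →
      ∃ H : Matrix (Fin (h + h)) (Fin (h + h)) ℂ, (Matrix.of fun i j : Fin r => (H.submatrix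
        (fun b : Fin h => if b ∈ u i then Fin.castAdd h b else Fin.natAdd h b)
        (fun b : Fin h => if b ∈ w j then Fin.natAdd h b else Fin.castAdd h b)).det).det ≠ 0)
    (h r : ℕ) (hr : r ≤ R) (u w : Fin r → Finset (Fin h)) (hu : Function.Injective u)
    (hw : Function.Injective w) :
    ∃ H : Matrix (Fin (h + h)) (Fin (h + h)) ℂ, (Matrix.of fun i j : Fin r => (H.submatrix
      (fun b : Fin h => if b ∈ u i then Fin.castAdd h b else Fin.natAdd h b)
      (fun b : Fin h => if b ∈ w j then Fin.natAdd h b else Fin.castAdd h b)).det).det ≠ 0 := by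
  classical
  induction h generalizing r with
  | zero =>
    rcases Nat.eq_zero_or_pos r with hr0 | hrpos
    · subst hr0
      exact ⟨0, by simp [Matrix.det_isEmpty]⟩
    refine tt_sameSize_of_lowerSets 0 r (fun u w hu hw hlu hlw => ?_) u w hu hw
    have hlk : ∀ (a c : Fin 0) (β γ : Bool),
        (Finset.univ.filter fun i => (a ∈ u i ↔ β = true)).card ≠
          (Finset.univ.filter fun j => (c ∈ w j ↔ γ = true)).card := fun a => Fin.elim0 a
    exact core 0 r hr (height_lt_of_locked u w hlu hlw hrpos hlk) u w hu hw hlu hlw hlk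
  | succ h ih =>
    induction r using Nat.strong_induction_on with
    | _ r ihr =>
    refine tt_sameSize_of_lowerSets (h + 1) r (fun u w hu hw hlu hlw => ?_) u w hu hw
    -- size 0 is trivial
    rcases Nat.eq_zero_or_pos r with hr0 | hrpos
    · subst hr0
      exact ⟨0, by simp [Matrix.det_isEmpty]⟩
    by_cases hlk : ∀ (a c : Fin (h + 1)) (β γ : Bool),
        (Finset.univ.filter fun i => (a ∈ u i ↔ β = true)).card ≠
          (Finset.univ.filter fun j => (c ∈ w j ↔ γ = true)).card
    · exact core (h + 1) r hr (height_lt_of_locked u w hlu hlw hrpos hlk) u w hu hw hlu hlw hlk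
    push Not at hlk
    -- an unlocked pair: classes of equal POSITIVE size `k`
    obtain ⟨a, c, β, γ, hkpos, hk⟩ : ∃ (a c : Fin (h + 1)) (β γ : Bool),
        0 < (Finset.univ.filter fun i => (a ∈ u i ↔ β = true)).card ∧
        (Finset.univ.filter fun i => (a ∈ u i ↔ β = true)).card =
          (Finset.univ.filter fun j => (c ∈ w j ↔ γ = true)).card := by
      obtain ⟨a, c, β, γ, hk⟩ := hlk
      by_cases h0 : (Finset.univ.filter fun i => (a ∈ u i ↔ β = true)).card = 0
      · refine ⟨a, c, !β, !γ, ?_, ?_⟩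
        · rw [card_filter_iff_not, h0]; omega
        · rw [card_filter_iff_not, card_filter_iff_not, ← hk]
      · exact ⟨a, c, β, γ, Nat.pos_of_ne_zero h0, hk⟩
    obtain ⟨k, hSk⟩ : ∃ k, (Finset.univ.filter fun i => (a ∈ u i ↔ β = true)).card = k :=
      ⟨_, rfl⟩
    obtain ⟨m, hkm⟩ : ∃ m, r = k + m := ⟨r - k, by
      have := Finset.card_le_univ (Finset.univ.filter fun i => (a ∈ u i ↔ β = true))
      simp only [Fintype.card_fin] at this; omega⟩
    subst hkm
    set S : Finset (Fin (k + m)) := Finset.univ.filter fun i => (a ∈ u i ↔ β = true) with hSdef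
    set T : Finset (Fin (k + m)) := Finset.univ.filter fun j => (c ∈ w j ↔ γ = true) with hTdef
    have hTk : T.card = k := hk.symm.trans hSk
    -- block re-indexings
    obtain ⟨σ, hσ1, hσ2⟩ := exists_blockPerm S hSk
    obtain ⟨τ, hτ1, hτ2⟩ := exists_blockPerm T hTk
    have hS : ∀ i, σ i ∈ S ↔ (a ∈ u (σ i) ↔ β = true) := fun i => by
      rw [hSdef, Finset.mem_filter]; simp
    have hT : ∀ j, τ j ∈ T ↔ (c ∈ w (τ j) ↔ γ = true) := fun j => by
      rw [hTdef, Finset.mem_filter]; simp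
    refine tt_layout_of_perm (h + 1) (k + m) u w σ τ ?_
    refine LiteralSplit.transversalLiteralPairSplit_route h k m (fun i => u (σ i)) (fun j => w (τ j))
      a c β γ ?_ ?_ ?_ ?_ ?_ ?_
    · intro i; exact (hS _).mp (hσ1 i)
    · intro i
      have hn := hσ2 i
      rw [hS] at hn
      revert hn
      cases β <;> simp
    · intro j; exact (hT _).mp (hτ1 j)
    · intro j
      have hn := hτ2 j
      rw [hT] at hn
      revert hn
      cases γ <;> simp
    · -- projected k-block, one dimension down, at most `k ≤ k + m ≤ R` members
      refine ih k (by omega) _ _ ?_ ?_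
      · refine proj_injective_of_const_bit (fun i => u (σ (Fin.castAdd m i))) ?_ a β
          (fun i => (hS _).mp (hσ1 i))
        intro i j hij
        exact Fin.castAdd_injective _ _ (σ.injective (hu hij))
      · refine proj_injective_of_const_bit (fun j => w (τ (Fin.castAdd m j))) ?_ c γ
          (fun j => (hT _).mp (hτ1 j))
        intro i j hij
        exact Fin.castAdd_injective _ _ (τ.injective (hw hij))
    · -- complementary m-block, same dimension, fewer members
      refine ihr m (by omega) (by omega) _ _ ?_ ?_
      · intro i j hij
        exact Fin.natAdd_injective _ _ (σ.injective (hu hij))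
      · intro i j hij
        exact Fin.natAdd_injective _ _ (τ.injective (hw hij))

end Summit.ValiantsHypothesis.ValiantsHypothesis.Theorems.BarrierLever.FiniteCheck
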